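import Literature.NumberTheory.DiophantineGeometry.BcgpResiduallyA5bModular
import Literature.NumberTheory.Automorphic.IsAutomorphicAE
import HarnessLib

/-!
# Boxer–Calegari–Gee–Pilloni 2021, Theorem 1.1.3: abelian surfaces over totally real fields are
# potentially automorphic (abelian-variety / `GL₄` almost-everywhere form)

Topic `Literature/NumberTheory/Automorphic`; namespace `Literature.NumberTheory.Automorphic`. ONE named
fact (D-0014), no proof, no new definition: the main theorem of G. Boxer, F. Calegari, T. Gee,
V. Pilloni, *Abelian surfaces over totally real fields are potentially modular*, Publ. Math. IHÉS 134
(2021) 153–501 (arXiv:1812.09269) — Theorem 1.1.3 (`theorem:main`; arXiv text p. 3): "Let `X` be either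
a genus two curve or an abelian surface over a totally real field `F`. Then `X` is potentially
automorphic.", with the authors' gloss (ibid.): "Here by potentially automorphic we mean that there
exists a finite Galois extension `L/F` such that the compatible system of Galois representations `𝓡`
attached to `H¹(X_{\bar ℚ}, ℚ_p)` (as `p` varies) over `L` is automorphic in a precisely circumscribed
sense which we make explicit in Definition 9.1.1" — proved in the body as Theorem 9.3.x
(`thm: potential modularity implies meromorphic continuation`, arXiv text p. 160: "Let `F` be a totally
real field, and let `A/F` be an abelian surface. Then `𝓡_A` is potentially automorphic …") from the
potential modularity theorem for `GSp₄` (challenging surfaces, Thm. `thm: MB GSp4 application`), the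
existing `GL₂` cases (Prop. `prop: a bunch of existing cases of potential modularity`, via [BLGGT]) and
the transfer `GSp₄ → GL₄` for representations of general type (Arthur's classification for `GSp₄`,
Gee–Taïbi; recorded in the tree as the edge `E_BCGP` of `Literature.NumberTheory.Automorphic.Arthur2013.Downstream`).

RENDERED here for ABELIAN SURFACES in the tree's scheme-theoretic model
`Literature.AlgebraicGeometry.Motives.AbelianVariety` with EXACTLY the hypothesis clause (framed dual of
the rational Tate module) of the accepted facts
`Literature.NumberTheory.DiophantineGeometry.bcgp_residuallyA5b_modular_abelianSurface` (BCGP Prop.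
10.1.1/10.1.3, abelian surfaces over `ℚ`) and
`Literature.NumberTheory.Automorphic.fls2015_modular_abelianVariety_dimOne_realQuadratic` (FLS 2015), and
with their almost-everywhere Satake–Frobenius conclusion clause read over the extension `L`.

## Source and reading

* Definition 9.1.1 (`defn: automorphic compatible system general number field`, arXiv text p. 155),
  verbatim: "Let `K` be a number field and let `𝓡` be a strictly compatible system of representations
  of `G_K`. We say that `𝓡` is automorphic if there is an automorphic representation `Π` of `GL_n(𝔸_K)`,
  with the properties that: (1) `Π` is an isobaric direct sum of cuspidal automorphic representations
  `⊞_{i=1}^r Π_i` where each `Π_i` is a `C`-algebraic cuspidal automorphic representation of some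
  `GL_{n_i}(𝔸_K)`. (2) The fixed field `M_Π` … is a number field. (3) For each finite place `v` of `K`,
  `WD_v(𝓡) = ⊕_i rec(Π_{i,v} |det|_v^{(1-n_i)/2})`."
* Definition (`defn: potentially automorphic abelian variety`, arXiv text p. 156), verbatim: "Let `A/K`
  be an abelian variety. We say that `A` is automorphic if `𝓡_A` is automorphic in the sense of
  Definition 9.1.1. We say that it is potentially automorphic if there is a finite extension of number
  fields `L/K` such that `𝓡_A|_{G_L}` is automorphic."  (`𝓡_A` = the compatible system
  `H¹_ét(A_{\bar K}, ℚ_p) = V_p(A)^∨`, §2.8 / §9.2 ibid.; the extension is GALOIS in Thm. 1.1.3's gloss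
  and in the proof of Thm. 9.3.x: "there is a Galois extension of totally real fields `F'/F` such that
  … `𝓡_A|_{G_{F''}}` … automorphic", resp. potentially abelian systems for types **D**, **F**.)

RENDERING. HYPOTHESES: `F` a totally real number field (`NumberField.IsTotallyReal F`); `A :
AbelianVariety F` with `A.dim = 2`; a prime `ℓ`, a `ℚ_ℓ`-basis `b` of `V_ℓ(A) = A.rationalTateModule ℓ`
(`DiophantineGeometry/AVGaloisModule`, `A.rationalTateRep ℓ`) and the FRAMED DUAL
`r : Γ_F → GL₄(ℚ̄_ℓ)` of `V_ℓ(A)` in the dual basis, `r(g) = [g⁻¹]_bᵀ` — one member `ρ_{A,ℓ}` (on `H¹`)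
of the paper's `𝓡_A`, VERBATIM the framed-dual clause of `bcgp_residuallyA5b_modular_abelianSurface`.
CONCLUSION (for every `ι : ℚ̄_ℓ ≃+* ℂ`): there are a finite Galois extension `L/F` (a number field `L`
with `Algebra F L`, `IsGalois F L`), the compactness input `isCompact_glFiniteIntegralLevel 4 L` that
the Borel–Jacquet datum takes, and an `L`-ALGEBRAIC AUTOMORPHIC representation `Π` of `GL₄(𝔸_L)`
(`AutomorphicRepData (AutomorphyDatum.gl 4 L _)` — NOT asserted cuspidal: it is the isobaric sum
`⊞_i Π_i|det|^{(1-n_i)/2}` of Definition 9.1.1, `L`-algebraic because each `C`-algebraic `Π_i` twisted by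
`|det|^{(1-n_i)/2}` is (Buzzard–Gee 2014, §2.1 / Lemma 5.3.? parity of `(n_i - 1)/2`), and genuinely
non-cuspidal when `ρ_{A,ℓ}|_{G_L}` is reducible — cf. the authors' caveat after Thm. 1.1.3, "some care
must be taken … if the `p`-adic Galois representations associated to `X` become reducible after
restriction to `L`") whose Satake parameters `a_w` satisfy, for all but finitely many finite places `w`
of `L`: `r|_{Γ_L}` (`FramedGaloisRep.restrictField L r`) is unramified at `w` and
`det(X − r|_{Γ_L}(Frob_w)) = arithFrobPolyOfSatake ι q_w 1 a_w` (arithmetic Frobenius, Buzzard–Gee's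
`L`-normalisation — the cofinite shadow of condition (3) of Definition 9.1.1 at the unramified places,
in the normalisation of the summit's `SatakeFrobCompatibleAt` / `IsAutomorphicAE` and of the two
accepted sibling facts).  The extension `L` is allowed to depend on `(ℓ, ι)` here (in print one `L`
serves the whole compatible system) — a weakening.

What is deliberately NOT here: the local–global compatibility at the ramified places and the
infinity type (condition (3) in full; the tree's Borel–Jacquet datum has Satake parameters at
unramified places as its only local vocabulary — the same restriction as `IsAutomorphicAE`, `bcgp_*`,
`fls2015_*`); the stronger "potentially MODULAR" statement for challenging surfaces (a cuspidal `π` on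
`GSp₄(𝔸_{F'})` of parallel weight `2`, `F'/F` Galois totally real, Thm. 9.3.y `thm: MB GSp4 application`
/ Def. 9.2.z), the meromorphic continuation of `L(H^i(A), s)` (Thm. 1.1.2), and genus-two CURVES (the
tree has no Jacobian construction).  The proof (higher Hida theory and the Taylor–Wiles–Kisin method
for `GSp₄` in irregular weight, the `2`-adic / `p = 3` residual arguments, Moret-Bailly) is a theory
absent from Mathlib and the tree; the dependence on Arthur's endoscopic classification for `GSp₄`
(announced; Gee–Taïbi) is the one the authors flag in §1.3 (arXiv text p. 10) and the tree records in
`Arthur2013/Downstream.lean`.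

## References

* [BoxerEtAl2021] G. Boxer, F. Calegari, T. Gee, V. Pilloni, Abelian surfaces over totally real fields
  are potentially modular, Publ. Math. IHÉS 134 (2021), 153–501, arXiv:1812.09269: Thm. 1.1.3
  (`theorem:main`) with its gloss; Def. 9.1.1 (automorphic compatible system over a number field);
  Def. `defn: potentially automorphic abelian variety` (§9.1); Thm. `thm: potential modularity implies
  meromorphic continuation` (§9.3) and its proof (Galois `F'/F`); §1.3 (dependence on Arthur).
* [GeeTaibi2019] T. Gee, O. Taïbi, Arthur's multiplicity formula for `GSp₄` and restriction to `Sp₄`,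
  J. Éc. polytech. Math. 6 (2019), 469–535: the transfer `GSp₄ → GL₄` for general type (used in §2.9 ibid.).
* [BuzzardGeeLMS2014] K. Buzzard, T. Gee, The conjectural connections between automorphic
  representations and Galois representations, LMS Lecture Notes 414 (2014): §2.1, Conj. 3.2.1
  (`L`- and `C`-algebraic, arithmetic Frobenius normalisation).
-/

namespace Literature.NumberTheory.Automorphic

open CategoryTheory IsDedekindDomain NumberField
open scoped NumberField Matrix Classical -- `Classical`: the place subtypes indexing `mixedSpace L` are `Fintype` classically (`NormedCommRing (mixedSpace L)`, needed to write `AutomorphyDatum.gl 4 L _`)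
open Literature.NumberTheory.GaloisRepresentations
open Literature.AlgebraicGeometry.Motives (AbelianVariety)

/-- **Boxer–Calegari–Gee–Pilloni 2021, Theorem 1.1.3** ("Let `X` be … an abelian surface over a totally
real field `F`. Then `X` is potentially automorphic": "there exists a finite Galois extension `L/F` such
that the compatible system … attached to `H¹(X_{\bar ℚ}, ℚ_p)` … over `L` is automorphic" in the sense of
Def. 9.1.1 — an isobaric sum `Π = ⊞ Π_i` of `C`-algebraic cuspidals on `GL₄(𝔸_L)` with
`WD_v(𝓡) = ⊕ rec(Π_{i,v}|det|^{(1-n_i)/2})` at every finite `v`), abelian-variety / `GL₄`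
almost-everywhere form.  For every totally real number field `F`, every abelian surface `A/F`
(`A.dim = 2`), every prime `ℓ`, every framed dual `r : Γ_F → GL₄(ℚ̄_ℓ)` of `V_ℓ(A)` in the dual basis
of a `ℚ_ℓ`-basis `b` (`r(g) = [g⁻¹]_bᵀ`, the paper's `ρ_{A,ℓ}` on `H¹`; VERBATIM the clause of
`bcgp_residuallyA5b_modular_abelianSurface`) and every `ι : ℚ̄_ℓ ≃+* ℂ`, there are a finite Galois
extension `L/F`, the compactness input `isCompact_glFiniteIntegralLevel 4 L`, and an `L`-algebraic
automorphic representation `Π` of `GL₄(𝔸_L)` (the `L`-normalised isobaric sum of Def. 9.1.1; not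
asserted cuspidal — `ρ_{A,ℓ}|_{G_L}` may be reducible) whose Satake parameters `a_w` satisfy, for all
but finitely many finite places `w` of `L`: `r|_{Γ_L}` is unramified at `w` and
`det(X − r|_{Γ_L}(Frob_w)) = arithFrobPolyOfSatake ι q_w 1 a_w` (arithmetic Frobenius, Buzzard–Gee
normalisation, as in `IsAutomorphicAE` and the sibling facts).  `L` may depend on `(ℓ, ι)` (a
weakening of print).  Depends in print on Arthur's classification for `GSp₄` (Gee–Taïbi), cf.
`Arthur2013.Downstream`.  Users take `(h : bcgp2021_potentiallyAutomorphic_abelianSurface)`.  Named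
fact (D-0014), not proved in the tree.
[cite: BoxerEtAl2021, Thm. 1.1.3 (theorem:main) and its gloss; Def. 9.1.1 (automorphic compatible system over a number field); §9.1 Def. (potentially automorphic abelian variety); §9.3 Thm. (potential modularity implies meromorphic continuation: "A/F abelian surface ⇒ R_A potentially automorphic"), arXiv:1812.09269 text pp. 3, 155–156, 160–161]
[cite: GeeTaibi2019, transfer GSp4 → GL4 for general type (Arthur's multiplicity formula)]
[cite: BuzzardGeeLMS2014, §2.1, Conj. 3.2.1 (L-algebraic normalisation, arithmetic Frobenius)] -/
def bcgp2021_potentiallyAutomorphic_abelianSurface : Prop :=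
  ∀ (F : Type) [Field F] [NumberField F] [IsTotallyReal F] (A : AbelianVariety F), A.dim = 2 →
    ∀ (ℓ : ℕ) [Fact ℓ.Prime] (b : Module.Basis (Fin 4) ℚ_[ℓ] (A.rationalTateModule ℓ))
      (r : FramedGaloisRep F (PadicAlgCl ℓ) 4),
      (∀ g : Field.absoluteGaloisGroup F,
        (r g).val =
          ((LinearMap.toMatrix b b (A.rationalTateRep ℓ g⁻¹)).map
            (algebraMap ℚ_[ℓ] (PadicAlgCl ℓ))).transpose) →
      ∀ (ι : PadicAlgCl ℓ ≃+* ℂ),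
        ∃ (L : Type) (_ : Field L) (_ : NumberField L) (_ : Algebra F L) (_ : IsGalois F L)
          (hcpt : isCompact_glFiniteIntegralLevel 4 L) (P : AutomorphicRepData (AutomorphyDatum.gl 4 L hcpt)),
          P.IsLAlgebraic ∧
            ∀ᶠ w : HeightOneSpectrum (𝓞 L) in Filter.cofinite, ∃ a : Multiset ℂ,
              P.HasSatakeParamAt w a ∧ (r.restrictField L).IsUnramifiedAt w ∧
                (r.restrictField L).HasFrobCharpolyAt w (arithFrobPolyOfSatake ι w.residueCard 1 a)

end Literature.NumberTheory.Automorphic
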